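import Literature.Algebra.Polynomial.CasasAlvero.Degree8Char797Closed
import Literature.Algebra.Polynomial.CasasAlvero.Degree8ScenarioCriterion
import Mathlib.Tactic.NormNum.Prime
import HarnessLib

/-!
# The Casas-Alvero conjecture in degree 8 holds in characteristic 797

This file PROVES, kernel-checked, that `797` is a GOOD prime for degree `8` in the sense of [CastryckLaterveerOunaies2012]
(`CA_8` holds in characteristic `797`):

* `holdsInDegree_eight_of_char_797` — `CA_8` over every field with `797 = 0`: the `876` reduced scenario systems are closed there
  (`degree8ScenariosClosed_of_char_797`, assembled from the kernel-evaluated certificates `Degree8Char797Cert*.lean` via `CertCheck.check`),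
  and the characteristic-free criterion `Degree8ScenariosClosed.holdsInDegree_eight` (`Degree8ScenarioCriterion.lean`) applies;
* `holdsInDegree_eight_mul_pow_of_char_797` — hence `CA_(8·797^k)` over every field of characteristic `797` ([GrafVonBothmerEtAl2007, Prop. 6] + descent).

`797` is bad for degree `7` (an explicit Casas-Alvero septic over `F_797` with `F_797`-rational witnesses, `Char797Digits.lean`), so — like `419` — its digit set contains `8` above the bad digit `7`;
the complete classification of characteristic `797` (`CharSevenHundredNinetySevenComplete.lean`) imports this file for the digit `8`.
The certificates were found by linear algebra over `F_797` (lottery cell `code/L4lean-g15/d8/certD.py`, unchanged, kit job j187881) and are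
re-verified here by the kernel; two further independent implementations (chain certificates from a recording Buchberger,
`code/L4lean-g19/implE/certE.py`, and Gröbner bases after elimination, `code/L4lean-g18/implC/implD_elim.py`, both in the block-6 map kit job j178965)
report every degree-8 scenario closed at `p = 797` as well, and a witness-first search finds no Casas-Alvero octic over `F_797` with `F_797`-rational witnesses (kit job j179661).  No `sorry`, no new axioms.
-/

set_option linter.style.longLine false

noncomputable section

open Polynomial

namespace Literature.Algebra.Polynomial.CasasAlvero

variable {K : Type*} [Field K]

/-- **`CA_8` in characteristic `797`.**  Over every field in which `797 = 0`, a monic polynomial of degree `8` each of whose Hasse derivatives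
`H_1 f, …, H_7 f` shares a root with `f` is `(X - a)^8`: `797` is a good prime for degree `8` (it is bad for degree `7` (`Char797Digits.lean`)).
[cite: CastryckLaterveerOunaies2012, Sec. 2] -/
theorem holdsInDegree_eight_of_char_797 (hp : (797 : K) = 0) : HoldsInDegree K 8 :=
  (degree8ScenariosClosed_of_char_797 hp).holdsInDegree_eight

/-- Hence `CA_(8·797^k)` over every field of characteristic `797`. [cite: CastryckLaterveerOunaies2012, Sec. 2] [cite: GrafVonBothmerEtAl2007, Prop. 6] -/
theorem holdsInDegree_eight_mul_pow_of_char_797 [CharP K 797] (k : ℕ) : HoldsInDegree K (8 * 797 ^ k) := by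
  haveI : Fact (Nat.Prime 797) := ⟨by norm_num⟩
  exact Degree8ScenariosClosed.holdsInDegree_eight_mul_prime_pow 797
    (degree8ScenariosClosed_of_char_797 (K := AlgebraicClosure K) (by simpa using CharP.cast_eq_zero (AlgebraicClosure K) 797)) k

end Literature.Algebra.Polynomial.CasasAlvero
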